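import Summits.QuantumFields.BalabanUV.Beta.FP.RemainderSymbolChain
import Summits.QuantumFields.BalabanUV.Beta.FP.MaxwellSymbolDeriv
import Summits.QuantumFields.BalabanUV.Beta.FP.DispersionSliceChain

/-!
# `BalabanUV.Beta.FP.RemainderSymbolSlice` — road «FP» for binder row D1, leaf H2-P, row H2-P-B (owner GO l.20595): the REMAINDER SYMBOL
# `B_w(s) := (feynMat (w s) (p̂ s))⁻¹ − |p̂ s|⁻²·𝟙` of a weighted Maxwell family along a coordinate slice `t ↦ update s i t` — its third-order chain NAMED
# and the graded letters `‖∂_tᵏ B_w‖ ≤ C·3^k∕‖s‖ᵏ` (k ≤ 3) at every slice point of the punctured zone, for an ABSTRACT weight `w` under the DISPLAYED rows of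
# `FP/MaxwellSymbolDeriv` (slice `C³`, `w − 1` graded `O(‖s‖^{2−n})`) plus invertibility and the coercive inverse letter `‖(feynMat (w s) (p̂ s))⁻¹ α β‖ ≤ c∕‖s‖²`
# (for the continuum (1.66) weights `w = Re W_∞`: `PerfectPropagatorSymbol.isUnit_det_feynMat` + `PerfectPropagatorBound.norm_PinfSym_d1Sym_le_inv_norm_sq`;
# the `w − 1` rows = H2-P-REG R2, after W166-HOLO (D))

HONEST DEPENDENCY (page 1, mandatory): continuum YM on T⁴ ⇐ BetaPertH ∧ nine spine estimates (0/9 proved); BetaPertH ⇐ (D1) ∧ (D4) ∧ CAP+tail;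
G-an2-4 gates asym, D1 and NE2/3/4.  HONEST FRAMING (cell contract, verbatim): «discharging `BetaPertH` makes Bałaban's UV stability UNCONDITIONAL —
a real constructive-QFT result; it is NOT the continuum limit and NOT the Clay problem.»  THIS MODULE DISCHARGES NOTHING of the wall: [folklore] bookkeeping over
`FP/RemainderSymbolChain` (p235361), `FP/MaxwellSymbolDeriv` (gan24-p3-g16, p234904), `FP/DispersionSliceChain` (p235073), `FP/InverseSymbolDeriv` (gan24-leaf-01-g46, p234411),
`FP/PerfectPropagatorSplit` (p233396).  Data defs = NAMES of the slice curves (`feynSl`, `excSl`, `remSl0…3`); no `def … : Prop`; the weight rows are HYPOTHESES displayed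
in every signature, nothing cited; 0 sorry; 0 wall binders; NOT D1, NOT BetaPertH, NOT continuum, NOT Clay.

ABSOLUTE RULE (cell charter, verbatim): «No internally-minted statement may enter as a cited fact. Every hypothesis is either kernel-proved in this package or a
verbatim quotation of a PUBLISHED theorem with page reference. The manuscript(s) under audit are NOT citable for their own disputed steps — they are the thing
under adjudication; programme-internal (2001/route/tribunal) claims are never citable.»

WHAT (lattice dimension `d + 1`; weight `w : Fin (d+1) → Fin (d+1) → (Fin (d+1) → ℝ) → ℝ`; base point `s`, direction `i`, transverse part `q := i.removeNth s`):
* §1 curves along the slice: `feynSl w s i j u γ β := iteratedDeriv j (t ↦ feynMat (w (update s i t)) (p̂ (update s i t)) γ β) u`, `excSl` (same for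
  `maxwellMat (w − 1)`), the scalar `DispersionSliceChain.fD q i` (= `|p̂|²` along the slice, `fD_update`), and **`remSl0 w s i α β u :=
  −((feynSl 0 u)⁻¹·excSl 0 u) α β·(fD q i u)⁻¹`** with `remSl1∕2∕3` = the `RemainderSymbolChain.bSl1∕2∕3` members on these curves; base-point invariance
  `feynSl_update`∕`excSl_update`∕`remSl_update` (the curves depend on `s` only through the line); **`remSl0_eq_sub_free`**: at `u`, `remSl0 = ((feynMat …)⁻¹) α β
  − [α = β]∕|p̂|²` (`PerfectPropagatorSplit.entry_sub_free_eq`) — it IS the remainder symbol.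
* §2 **`hasDerivAt_remSl0∕1∕2`**: `(remSl_k)′ = remSl_{k+1}` at every `t` with `update s i t` in the punctured zone (weight rows: slice `C³`; invertibility row).
* §3 **`norm_remSl_le`**: at such `t`, with `p := update s i t`, `‖remSl_k … t‖ ≤ 3^k·K·c∕‖p‖ᵏ`, `K = (d+1)·aSum(…)·(128(d+1)²M⁶cw)`, `c = cSum (4∕π²) 2 2 2 M`, the
  `InverseSymbolDeriv` constants `c₀ = (d+1)·cinv`, `c₁ = c₂ = c₃ = (d+1)·(128(d+1)²M⁴(M²cw+1) + 8M²)` — i.e. **`∂_tᵏ B_w = O(‖s‖^{−k})` on the punctured zone**, the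
  letters `PuncturedCoordDeriv` + `BrillouinRadial` turn into `∂ᵏB ∈ L¹(BZ 4)` and the `O(‖z‖^{−3})` kernel rate (H2-P-KER-ASM, owner).
Provenance: G-an2-4 swarm leaf prover 05, gen 34 (prover-b2b-balaban-gan24-formalise-leaf-05-g34-0), cross-lane on road FP (row H2-P-B claim l.20249), 2026-08-20.

v1.1 NOTE (docstring only; gen 35, located issue CLAIMS l.21819 ∕ owner finding F-FP-5-1 l.21879): §2–§3 display the weight regularity in R1's GLOBAL currency
`hwC : ContDiff ℝ 3 (t ↦ ((w μ ν (update s i t) : ℝ) : ℂ))` (for every base point in §3).  For an abstract weight this is a legitimate hypothesis; for the road's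
instance `w := Re W_∞` it is NOT instantiable (the Lean object `W166Inf` has unremoved removable singularities at real momenta in `2πℤ ∖ {0}`, gan24-p3-g16
CLAIMS l.20785; H2-P-REG R2 is accordingly LOCAL, `FP/PerfectSymbolDeriv`).  The road therefore reads the chain for `Re W_∞` from the LOCAL re-run
`FP/PerfectRemainderSliceLocal(Letters)` (p238395 ∕ p238536: the same data defs `feynSl`, `excSl`, `remSl0…3` of this file, links on the open interval
`Ioo (−(π+δ₁₆₆)) (π+δ₁₆₆)`, unconditional letters `3ᵏ·Krem d∕‖p‖ᵏ`) and, at every order, from d1-formalise-leaf-01's `FP/RemainderSymbolSliceN` (pointwise `ContDiffAt`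
rows).  §1 and `remSl0_eq_sub_free` are unaffected.  The base-point invariance `remSl_update` announced above is proved as
`PerfectRemainderSliceLocal.remSl0∕1∕2∕3_update`.
-/

noncomputable section

namespace Summit.QuantumFields.BalabanUV.Beta.FP.RemainderSymbolSlice

open Matrix Filter Finset
open scoped Matrix.Norms.Operator BigOperators
open Literature.MathematicalPhysics.QuantumFieldTheory.Balaban1983to89
open B4ContourShift (BZ)
open B5Prop11Fiber (d1Sym)
open Literature.Probability.LatticeModels (dispersion)
open Summit.QuantumFields.BalabanUV.Beta.FP.PerfectPropagatorSymbol (feynMat maxwellMat)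
open Summit.QuantumFields.BalabanUV.Beta.FP.PerfectPropagatorSplit (entry_sub_free_eq)
open Summit.QuantumFields.BalabanUV.Beta.FP.PerfectPropagatorBound (sum_norm_d1Sym_sq)
open Summit.QuantumFields.BalabanUV.Beta.FP.MatrixInvDeriv (hasDerivAt_of_entries)
open Summit.QuantumFields.BalabanUV.Beta.FP.InverseSymbolDeriv (invD1 invD2 invD3)
open Summit.QuantumFields.BalabanUV.Beta.FP.MaxwellSymbolDeriv (contDiff_feyn_entry contDiff_excess_entry graded_feyn_entry graded_excess_entry
  hasDerivAt_iteratedDeriv_slice iteratedDeriv_slice_update update_insertNth)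
open Summit.QuantumFields.BalabanUV.Beta.FP.DispersionSliceChain (fD fD1 fD2 fD3 fD_eq hasDerivAt_fD hasDerivAt_fD1 hasDerivAt_fD2 fD_pos norm_sq_le_fD
  abs_fD1_le abs_fD2_le abs_fD3_le insertNth_mem_BZ)
open Summit.QuantumFields.BalabanUV.Beta.FP.RemainderSymbolChain (bSl0 bSl1 bSl2 bSl3 aSum cSum hasDerivAt_bSl0 hasDerivAt_bSl1 hasDerivAt_bSl2 norm_bSl_le)
open Summit.QuantumFields.BalabanUV.Beta.GAN24.InverseRate (norm_le_card_mul)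

variable {d : ℕ}

/-! ## §1 The curves along the slice -/

section Curves

variable (w : Fin (d + 1) → Fin (d + 1) → (Fin (d + 1) → ℝ) → ℝ) (s : Fin (d + 1) → ℝ) (i : Fin (d + 1))

/-- [our object] `feynSl j u := (iteratedDeriv j of the entries of feynMat (w ·) (p̂ ·) along t ↦ update s i t) at u`, as a matrix. -/
def feynSl (j : ℕ) (u : ℝ) : Matrix (Fin (d + 1)) (Fin (d + 1)) ℂ :=
  fun γ β => iteratedDeriv j (fun t : ℝ => feynMat (fun μ ν => w μ ν (Function.update s i t)) (d1Sym (Function.update s i t)) γ β) u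

/-- [our object] `excSl j u` := the same for the excess `maxwellMat (w − 1) (p̂ ·)`. -/
def excSl (j : ℕ) (u : ℝ) : Matrix (Fin (d + 1)) (Fin (d + 1)) ℂ :=
  fun γ β => iteratedDeriv j (fun t : ℝ => maxwellMat (fun μ ν => w μ ν (Function.update s i t) - 1) (d1Sym (Function.update s i t)) γ β) u

/-- [our object] **THE REMAINDER SYMBOL ALONG THE SLICE**: `remSl0 α β u := −((feynSl 0 u)⁻¹ · excSl 0 u) α β · (2ε(update s i u))⁻¹`. -/
def remSl0 (α β : Fin (d + 1)) (u : ℝ) : ℂ := bSl0 (feynSl w s i 0) (excSl w s i 0) (fD (i.removeNth s) i) α β u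
/-- [our object] first member of the chain. -/
def remSl1 (α β : Fin (d + 1)) (u : ℝ) : ℂ :=
  bSl1 (feynSl w s i 0) (feynSl w s i 1) (excSl w s i 0) (excSl w s i 1) (fD (i.removeNth s) i) fD1 α β u
/-- [our object] second member. -/
def remSl2 (α β : Fin (d + 1)) (u : ℝ) : ℂ :=
  bSl2 (feynSl w s i 0) (feynSl w s i 1) (feynSl w s i 2) (excSl w s i 0) (excSl w s i 1) (excSl w s i 2) (fD (i.removeNth s) i) fD1 fD2 α β u
/-- [our object] third member. -/
def remSl3 (α β : Fin (d + 1)) (u : ℝ) : ℂ :=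
  bSl3 (feynSl w s i 0) (feynSl w s i 1) (feynSl w s i 2) (feynSl w s i 3) (excSl w s i 0) (excSl w s i 1) (excSl w s i 2) (excSl w s i 3)
    (fD (i.removeNth s) i) fD1 fD2 fD3 α β u

/-- [folklore] order zero is the symbol itself. -/
theorem feynSl_zero (u : ℝ) :
    feynSl w s i 0 u = feynMat (fun μ ν => w μ ν (Function.update s i u)) (d1Sym (Function.update s i u)) := by
  funext γ β; simp [feynSl]

/-- [folklore] … and for the excess. -/
theorem excSl_zero (u : ℝ) :
    excSl w s i 0 u = maxwellMat (fun μ ν => w μ ν (Function.update s i u) - 1) (d1Sym (Function.update s i u)) := by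
  funext γ β; simp [excSl]

/-- [folklore] `update s i u = i.insertNth u (i.removeNth s)`. -/
theorem update_eq_insertNth (u : ℝ) : Function.update s i u = i.insertNth u (i.removeNth s) := by
  conv_lhs => rw [← Fin.insertNth_self_removeNth i s]
  exact update_insertNth i (s i) u (i.removeNth s)

/-- [folklore] the scalar factor: `fD (removeNth i s) i u = Σ_a ‖p̂_a (update s i u)‖² = 2ε(update s i u)`. -/
theorem fD_eq_sum_norm_sq (u : ℝ) : fD (i.removeNth s) i u = ∑ a, ‖d1Sym (Function.update s i u) a‖ ^ 2 := by
  rw [sum_norm_d1Sym_sq, update_eq_insertNth]; rfl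

end Curves

/-! ## §1b Base-point invariance and the identification with `P − |p̂|⁻²𝟙` -/

section Ident

variable (w : Fin (d + 1) → Fin (d + 1) → (Fin (d + 1) → ℝ) → ℝ) (s : Fin (d + 1) → ℝ) (i : Fin (d + 1))

/-- [folklore] the curves depend on the base point only through the line: `feynSl w (update s i t₀) i = feynSl w s i`. -/
theorem feynSl_update (t₀ : ℝ) : feynSl w (Function.update s i t₀) i = feynSl w s i := by
  funext j u γ β; simp [feynSl, Function.update_idem]

/-- [folklore] … `excSl w (update s i t₀) i = excSl w s i`. -/
theorem excSl_update (t₀ : ℝ) : excSl w (Function.update s i t₀) i = excSl w s i := by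
  funext j u γ β; simp [excSl, Function.update_idem]

/-- [folklore] … `removeNth i (update s i t₀) = removeNth i s`. -/
theorem removeNth_update (t₀ : ℝ) : i.removeNth (Function.update s i t₀) = i.removeNth s := by
  funext a; simp [Fin.removeNth]

/-- [our object] **`remSl0` IS THE REMAINDER SYMBOL**: if `feynSl 0 u` is invertible and the slice point is not the origin of `p̂`, then
`remSl0 α β u = ((feynMat (w p) (p̂ p))⁻¹) α β − [α = β]∕Σ‖p̂ p‖²`, `p = update s i u` (`PerfectPropagatorSplit.entry_sub_free_eq`). -/
theorem remSl0_eq_sub_free (α β : Fin (d + 1)) (u : ℝ)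
    (hdet : IsUnit (feynMat (fun μ ν => w μ ν (Function.update s i u)) (d1Sym (Function.update s i u))).det)
    (hph : 0 < ∑ a, ‖d1Sym (Function.update s i u) a‖ ^ 2) :
    remSl0 w s i α β u
      = (feynMat (fun μ ν => w μ ν (Function.update s i u)) (d1Sym (Function.update s i u)))⁻¹ α β
        - (if α = β then ((((∑ a, ‖d1Sym (Function.update s i u) a‖ ^ 2 : ℝ))⁻¹ : ℝ) : ℂ) else 0) := by
  have hP := entry_sub_free_eq (Matrix.nonsing_inv_mul _ hdet) hph α β
  rw [hP]
  unfold remSl0 bSl0 RemainderSymbolChain.uSl0 RemainderSymbolChain.zSl0 SliceReciprocalChain.rc0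
  rw [feynSl_zero, excSl_zero, fD_eq_sum_norm_sq, Matrix.mul_apply]
  ring

end Ident

/-! ## §2 The chain `(remSl_k)′ = remSl_{k+1}` along the slice -/

section Chain

variable {w : Fin (d + 1) → Fin (d + 1) → (Fin (d + 1) → ℝ) → ℝ} {s : Fin (d + 1) → ℝ} {i : Fin (d + 1)} {t : ℝ}
  (hwC : ∀ μ ν, ContDiff ℝ 3 (fun t : ℝ => ((w μ ν (Function.update s i t) : ℝ) : ℂ)))
  (hdet : IsUnit (feynMat (fun μ ν => w μ ν (Function.update s i t)) (d1Sym (Function.update s i t))).det)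
  (hq : i.removeNth s ∈ BZ d) (hq0 : i.removeNth s ≠ 0)

include hwC in
/-- [folklore] the matrix-valued links `(feynSl j)′ = feynSl (j+1)` (j < 3) from the slice `C³` row (`hasDerivAt_iteratedDeriv_slice` entrywise +
`MatrixInvDeriv.hasDerivAt_of_entries`). -/
theorem hasDerivAt_feynSl {j : ℕ} (hj : j < 3) (u : ℝ) : HasDerivAt (feynSl w s i j) (feynSl w s i (j + 1) u) u :=
  hasDerivAt_of_entries fun γ β =>
    hasDerivAt_iteratedDeriv_slice (G := fun x => feynMat (fun μ ν => w μ ν x) (d1Sym x) γ β) (s := s) (i := i)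
      (contDiff_feyn_entry w s i hwC γ β) hj u

include hwC in
/-- [folklore] the entrywise links `(excSl j)′ = excSl (j+1)` (j < 3). -/
theorem hasDerivAt_excSl {j : ℕ} (hj : j < 3) (u : ℝ) (γ β : Fin (d + 1)) :
    HasDerivAt (fun v => excSl w s i j v γ β) (excSl w s i (j + 1) u γ β) u :=
  hasDerivAt_iteratedDeriv_slice (G := fun x => maxwellMat (fun μ ν => w μ ν x - 1) (d1Sym x) γ β) (s := s) (i := i)
    (contDiff_excess_entry w s i hwC γ β) hj u

include hdet in
/-- [folklore] invertibility of the order-zero curve at `t`. -/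
theorem isUnit_det_feynSl_zero : IsUnit (feynSl w s i 0 t).det := by
  rw [feynSl_zero]; exact hdet

include hwC hdet hq hq0 in
/-- [our object] **`(remSl0)′ = remSl1` at `t`.** -/
theorem hasDerivAt_remSl0 (α β : Fin (d + 1)) : HasDerivAt (remSl0 w s i α β) (remSl1 w s i α β t) t := by
  unfold remSl0 remSl1
  exact hasDerivAt_bSl0 (hasDerivAt_feynSl hwC (by norm_num) t) (isUnit_det_feynSl_zero hdet)
    (fun γ β => hasDerivAt_excSl hwC (by norm_num) t γ β) (hasDerivAt_fD _ i t) (fD_pos hq hq0 i t).ne' α β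

include hwC hdet hq hq0 in
/-- [our object] **`(remSl1)′ = remSl2` at `t`.** -/
theorem hasDerivAt_remSl1 (α β : Fin (d + 1)) : HasDerivAt (remSl1 w s i α β) (remSl2 w s i α β t) t := by
  unfold remSl1 remSl2
  exact hasDerivAt_bSl1 (hasDerivAt_feynSl hwC (by norm_num) t) (hasDerivAt_feynSl hwC (by norm_num) t) (isUnit_det_feynSl_zero hdet)
    (fun γ β => hasDerivAt_excSl hwC (by norm_num) t γ β) (fun γ β => hasDerivAt_excSl hwC (by norm_num) t γ β)
    (hasDerivAt_fD _ i t) (hasDerivAt_fD1 t) (fD_pos hq hq0 i t).ne' α β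

include hwC hdet hq hq0 in
/-- [our object] **`(remSl2)′ = remSl3` at `t`.** -/
theorem hasDerivAt_remSl2 (α β : Fin (d + 1)) : HasDerivAt (remSl2 w s i α β) (remSl3 w s i α β t) t := by
  unfold remSl2 remSl3
  exact hasDerivAt_bSl2 (hasDerivAt_feynSl hwC (by norm_num) t) (hasDerivAt_feynSl hwC (by norm_num) t) (hasDerivAt_feynSl hwC (by norm_num) t)
    (isUnit_det_feynSl_zero hdet)
    (fun γ β => hasDerivAt_excSl hwC (by norm_num) t γ β) (fun γ β => hasDerivAt_excSl hwC (by norm_num) t γ β)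
    (fun γ β => hasDerivAt_excSl hwC (by norm_num) t γ β)
    (hasDerivAt_fD _ i t) (hasDerivAt_fD1 t) (hasDerivAt_fD2 t) (fD_pos hq hq0 i t).ne' α β

end Chain

/-! ## §3 The graded letters `‖remSl_k‖ ≤ 3^k·K·c ∕ ‖p‖ᵏ` on the punctured zone -/

section Letters

variable {w : Fin (d + 1) → Fin (d + 1) → (Fin (d + 1) → ℝ) → ℝ} {s : Fin (d + 1) → ℝ} {i : Fin (d + 1)} {t cw M cinv : ℝ}
  (hwC : ∀ p : Fin (d + 1) → ℝ, ∀ μ ν, ContDiff ℝ 3 (fun t : ℝ => ((w μ ν (Function.update p i t) : ℝ) : ℂ)))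
  (hcw : 0 ≤ cw)
  (hw : ∀ p ∈ BZ (d + 1), ∀ μ ν, ∀ n ≤ 3,
    ‖iteratedDeriv n (fun t : ℝ => ((w μ ν (Function.update p i t) : ℝ) : ℂ) - 1) (p i)‖ ≤ cw * ‖p‖ ^ (2 - n))
  (hπM : Real.pi ≤ M)
  (hdet : ∀ p ∈ BZ (d + 1), p ≠ 0 → IsUnit (feynMat (fun μ ν => w μ ν p) (d1Sym p)).det)
  (hinv : ∀ p ∈ BZ (d + 1), p ≠ 0 → ∀ α β, ‖(feynMat (fun μ ν => w μ ν p) (d1Sym p))⁻¹ α β‖ ≤ cinv / ‖p‖ ^ 2)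
  (ht : t ∈ Set.Icc (-Real.pi) Real.pi) (hq : i.removeNth s ∈ BZ d) (hq0 : i.removeNth s ≠ 0)

/-- [folklore] `1 ≤ M` from `π ≤ M`. -/
theorem one_le_of_pi_le {M : ℝ} (hπM : Real.pi ≤ M) : 1 ≤ M := by linarith [Real.pi_gt_three]

include ht hq hq0 in
/-- [folklore] the slice point `p = update s i t` lies in the punctured zone; `0 < ‖p‖ ≤ π`. -/
theorem slicePt_facts :
    Function.update s i t ∈ BZ (d + 1) ∧ Function.update s i t ≠ 0 ∧ 0 < ‖Function.update s i t‖ ∧ ‖Function.update s i t‖ ≤ Real.pi := by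
  have e := update_eq_insertNth s i t
  have hmem : Function.update s i t ∈ BZ (d + 1) := by rw [e]; exact insertNth_mem_BZ i ht hq
  have hpos : 0 < ‖Function.update s i t‖ := by rw [e]; exact DispersionSliceChain.norm_insertNth_pos i t hq0
  have hne : Function.update s i t ≠ 0 := norm_pos_iff.mp hpos
  have hle : ‖Function.update s i t‖ ≤ Real.pi := by rw [e]; exact DispersionSliceChain.norm_insertNth_le_pi i ht hq
  exact ⟨hmem, hne, hpos, hle⟩

include hwC hcw hw hπM hinv ht hq hq0 in
/-- [our object] **THE GRADED LETTERS OF THE REMAINDER SYMBOL ALONG THE SLICE**: with `p := update s i t` (punctured zone), `n := d + 1`,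
`Cf := 128·n²·M⁴·(M²cw + 1) + 8M²`, `Cx := 128·n²·M⁶·cw`, `K := n·aSum (n·cinv) (n·Cf) (n·Cf) (n·Cf) M·Cx`, `c := cSum (4∕π²) 2 2 2 M`:
`‖remSl0 t‖ ≤ Kc`, `‖remSl1 t‖ ≤ 3Kc∕‖p‖`, `‖remSl2 t‖ ≤ 9Kc∕‖p‖²`, `‖remSl3 t‖ ≤ 27Kc∕‖p‖³`. -/
theorem norm_remSl_le (α β : Fin (d + 1)) :
    let n : ℝ := Fintype.card (Fin (d + 1))
    let Cf : ℝ := 128 * ((d + 1 : ℕ) : ℝ) ^ 2 * M ^ 4 * (M ^ 2 * cw + 1) + 8 * M ^ 2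
    let Cx : ℝ := 128 * ((d + 1 : ℕ) : ℝ) ^ 2 * M ^ 6 * cw
    let K : ℝ := n * (aSum (n * cinv) (n * Cf) (n * Cf) (n * Cf) M * Cx)
    let c : ℝ := cSum (4 / Real.pi ^ 2) 2 2 2 M
    let r : ℝ := ‖Function.update s i t‖
    ‖remSl0 w s i α β t‖ ≤ K * c ∧ ‖remSl1 w s i α β t‖ ≤ 3 * (K * c) / r ∧
      ‖remSl2 w s i α β t‖ ≤ 9 * (K * c) / r ^ 2 ∧ ‖remSl3 w s i α β t‖ ≤ 27 * (K * c) / r ^ 3 := by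
  intro n Cf Cx K c r
  obtain ⟨hmem, hne, hpos, hle⟩ := slicePt_facts ht hq hq0 (s := s) (i := i)
  set p := Function.update s i t with hp_def
  have hM1 : 1 ≤ M := one_le_of_pi_le hπM
  have hpM : ‖p‖ ≤ M := hle.trans hπM
  have hpi : p i = t := by simp [hp_def]
  -- the feyn letters at base point p, read on the curve based at s
  have hfeyn : ∀ k ≤ 3, ∀ γ β, ‖feynSl w s i k t γ β‖ ≤ Cf * ‖p‖ ^ (2 - k) := by
    intro k hk γ β
    have h := graded_feyn_entry w p i (hwC p) hcw (hw p hmem) hpM hM1 γ β k hk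
    have e : iteratedDeriv k (fun u : ℝ => feynMat (fun μ ν => w μ ν (Function.update p i u)) (d1Sym (Function.update p i u)) γ β) (p i)
        = feynSl w s i k t γ β := by
      unfold feynSl; rw [hp_def]
      exact iteratedDeriv_slice_update (fun x => feynMat (fun μ ν => w μ ν x) (d1Sym x) γ β) s i k t
    rw [e] at h; exact h
  have hexc : ∀ k ≤ 3, ∀ γ β, ‖excSl w s i k t γ β‖ ≤ Cx * ‖p‖ ^ (4 - k) := by
    intro k hk γ β
    have h := graded_excess_entry w p i (hwC p) hcw (hw p hmem) hpM hM1 γ β k hk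
    have e : iteratedDeriv k (fun u : ℝ => maxwellMat (fun μ ν => w μ ν (Function.update p i u) - 1) (d1Sym (Function.update p i u)) γ β) (p i)
        = excSl w s i k t γ β := by
      unfold excSl; rw [hp_def]
      exact iteratedDeriv_slice_update (fun x => maxwellMat (fun μ ν => w μ ν x - 1) (d1Sym x) γ β) s i k t
    rw [e] at h; exact h
  -- op-norm letters for the `InverseSymbolDeriv` chain
  have hCf0 : 0 ≤ Cf := by positivity
  have hcinv0 : 0 ≤ cinv := by
    have := (norm_nonneg _).trans (hinv p hmem hne α α)
    by_contra hc; push Not at hc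
    have : cinv / ‖p‖ ^ 2 < 0 := div_neg_of_neg_of_pos hc (by positivity)
    linarith
  have l0 : ‖(feynSl w s i 0 t)⁻¹‖ ≤ n * cinv / ‖p‖ ^ 2 := by
    rw [feynSl_zero, mul_div_assoc]
    exact norm_le_card_mul _ (by positivity) (hinv p hmem hne)
  have l1 : ‖feynSl w s i 1 t‖ ≤ n * Cf * ‖p‖ := by
    have h := norm_le_card_mul _ (by positivity : (0:ℝ) ≤ Cf * ‖p‖ ^ (2 - 1)) (hfeyn 1 (by norm_num))
    calc ‖feynSl w s i 1 t‖ ≤ n * (Cf * ‖p‖ ^ (2 - 1)) := h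
      _ = n * Cf * ‖p‖ := by norm_num; ring
  have l2 : ‖feynSl w s i 2 t‖ ≤ n * Cf := by
    have h := norm_le_card_mul _ (by positivity : (0:ℝ) ≤ Cf * ‖p‖ ^ (2 - 2)) (hfeyn 2 (by norm_num))
    calc ‖feynSl w s i 2 t‖ ≤ n * (Cf * ‖p‖ ^ (2 - 2)) := h
      _ = n * Cf := by norm_num
  have l3 : ‖feynSl w s i 3 t‖ ≤ n * Cf := by
    have h := norm_le_card_mul _ (by positivity : (0:ℝ) ≤ Cf * ‖p‖ ^ (2 - 3)) (hfeyn 3 le_rfl)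
    calc ‖feynSl w s i 3 t‖ ≤ n * (Cf * ‖p‖ ^ (2 - 3)) := h
      _ = n * Cf := by norm_num
  -- entry letters for the excess chain
  have m0 : ∀ γ β, ‖excSl w s i 0 t γ β‖ ≤ Cx * ‖p‖ ^ 4 := fun γ β => by simpa using hexc 0 (by norm_num) γ β
  have m1 : ∀ γ β, ‖excSl w s i 1 t γ β‖ ≤ Cx * ‖p‖ ^ 3 := fun γ β => by simpa using hexc 1 (by norm_num) γ β
  have m2 : ∀ γ β, ‖excSl w s i 2 t γ β‖ ≤ Cx * ‖p‖ ^ 2 := fun γ β => by simpa using hexc 2 (by norm_num) γ β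
  have m3 : ∀ γ β, ‖excSl w s i 3 t γ β‖ ≤ Cx * ‖p‖ := fun γ β => by simpa using hexc 3 le_rfl γ β
  -- scalar letters
  have e := update_eq_insertNth s i t
  have pf : 4 / Real.pi ^ 2 * ‖p‖ ^ 2 ≤ |fD (i.removeNth s) i t| := by
    rw [abs_of_pos (fD_pos hq hq0 i t), hp_def, e]; exact norm_sq_le_fD i ht hq
  have pf1 : |fD1 t| ≤ 2 * ‖p‖ := by rw [hp_def, e]; exact abs_fD1_le i t _
  have pf2 : |fD2 t| ≤ 2 := abs_fD2_le t
  have pf3 : |fD3 t| ≤ 2 := abs_fD3_le t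
  have hκ : (0 : ℝ) < 4 / Real.pi ^ 2 := by positivity
  -- assemble
  have h := norm_bSl_le (A₀ := feynSl w s i 0) (A₁ := feynSl w s i 1) (A₂ := feynSl w s i 2) (A₃ := feynSl w s i 3)
    (M₀ := excSl w s i 0) (M₁ := excSl w s i 1) (M₂ := excSl w s i 2) (M₃ := excSl w s i 3)
    (f := fD (i.removeNth s) i) (f₁ := fD1) (f₂ := fD2) (f₃ := fD3)
    hpos hpM hκ l0 l1 l2 l3 m0 m1 m2 m3 pf pf1 pf2 pf3 α β
  unfold remSl0 remSl1 remSl2 remSl3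
  exact h

end Letters

end Summit.QuantumFields.BalabanUV.Beta.FP.RemainderSymbolSlice

end
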